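import Summits.Ventures.Crystal3D.Theorems.StickyWulffConstantCoaxialWallLawSeamJunkCapTableThree
import HarnessLib

/-!
# The junk cap table for ANY CAP-CLOSED CORE in the payer window: `IsCapClosed X z D`, the rows re-proved in that generality, and `JunkCapBoundClosed capTable₂`
# (crux `CoaxialWallLaw`, stmt-Ventures-19481; line `WallLedgerF`, skeleton 'CoaxialWallLawCertificates' v8.1, stub `stub_incoherentSeamSmall`; F-TAIL-g12 §7)

HONEST FRAMING. Venture `Summits/Ventures/Crystal3D` (cell `crystal3d-full`); the cap-table rows of `…SeamJunkCapRows/…HealCapTen/…SeamJunkCapTableTwo/…HealCapHexFive`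
were stated for the canonical core `coreOf X z S` but their proofs use only two properties of the core `D`: it lies in the payer window `X ∩ B̄(z, 3)` and it is
CAP-CLOSED there (a window ball capping a unit triangle of `D` belongs to `D`).  The multi-piece split (F-TAIL-g12 §7) needs the table for pieces whose site
lattice is anchored at a reader or target rather than at the payer; this file supplies it once for all cap-closed cores.  Nothing about the stubs is claimed;
F-C1 not moved.
* `IsCapClosed X z D`; `isCapClosed_coreOf` (the canonical core is cap-closed);
* rows for a cap-closed core: `junk_le_two_of_nine_closed`, `junk_le_one_of_ten_closed`, `junk_eq_zero_of_eleven_closed`, `junk_le_four_of_hexagon_closed`,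
  `junk_le_one_of_tenHcp_closed`, `junk_le_three_of_hexFive_closed`, `junk_le_kissing_closed`;
* **`JunkCapBoundClosed cap`** (the junk bound over all cap-closed cores) and **`junkCapBoundClosed_capTable₂`**; `junkCapBound_of_closed` (it implies `JunkCapBound`).
-/

noncomputable section

namespace Summit.Ventures.Crystal3D.Theorems

namespace TailResidue

open Summit.Ventures.Crystal3D Finset NearIdentity
open Literature.MathematicalPhysics.StatisticalMechanics (basalMirror)
open scoped InnerProductSpace

/-! ### Cap-closed cores -/

/-- **CAP-CLOSED CORE** in the payer window: `D ⊆ X ∩ B̄(z, 3)` and every window ball capping a unit triangle of `D` belongs to `D`. -/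
def IsCapClosed (X : Finset (EuclideanSpace ℝ (Fin 3))) (z : EuclideanSpace ℝ (Fin 3)) (D : Finset (EuclideanSpace ℝ (Fin 3))) : Prop :=
  (∀ x ∈ D, x ∈ X ∧ dist z x ≤ 3) ∧ ∀ x ∈ X, dist z x ≤ 3 → CapsTriangleIn D x → x ∈ D

open scoped Classical in
/-- The canonical core `coreOf X z S` is cap-closed. -/
theorem isCapClosed_coreOf (X : Finset (EuclideanSpace ℝ (Fin 3))) (z : EuclideanSpace ℝ (Fin 3)) (S : EuclideanSpace ℝ (Fin 3) ≃ₗᵢ[ℝ] EuclideanSpace ℝ (Fin 3)) :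
    IsCapClosed X z (coreOf X z S) :=
  ⟨fun _ hx => mem_filter.1 (coreOf_subset_window X z S hx),
    fun _ hx hzx hcap => mem_capClosure_of_capsTriangleIn (siteBallsAt_subset _ _ _) (mem_filter.2 ⟨hx, hzx⟩) hcap⟩

namespace IsCapClosed

variable {X D : Finset (EuclideanSpace ℝ (Fin 3))} {z : EuclideanSpace ℝ (Fin 3)}

/-- A cap-closed core lies in the configuration. -/
theorem subset (h : IsCapClosed X z D) : D ⊆ X := fun x hx => (h.1 x hx).1

/-- **Maximality at a contact**: a ball of `X` outside the core at distance `1` from a core ball `y` within `2` of the payer caps no core triangle. -/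
theorem not_caps (h : IsCapClosed X z D) {y x : EuclideanSpace ℝ (Fin 3)} (hzy : dist z y ≤ 2) (hx : x ∈ X) (hxD : x ∉ D) (hyx : dist y x = 1) :
    ¬ CapsTriangleIn D x := fun hcap => hxD (h.2 x hx (by linarith [dist_triangle z y x]) hcap)

end IsCapClosed

/-! ### The rows for a cap-closed core -/

section Rows

variable {X D : Finset (EuclideanSpace ℝ (Fin 3))} (hX : ∀ p ∈ X, ∀ q ∈ X, p ≠ q → 1 ≤ dist p q) {z : EuclideanSpace ℝ (Fin 3)} (hD : IsCapClosed X z D)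
  {y : EuclideanSpace ℝ (Fin 3)} (hy : y ∈ D) (hzy : dist z y ≤ 2) (L : EuclideanSpace ℝ (Fin 3) ≃ₗᵢ[ℝ] EuclideanSpace ℝ (Fin 3))

include hX hD hy hzy in
open scoped Classical in
/-- Row «closed lower half-dozen ⇒ ≤ 2» for a cap-closed core. -/
theorem junk_le_two_of_nine_closed (hocc : ∀ k ∈ lowerNine, y + L (slotSite k) ∈ D) : ((X \ D).filter fun x => dist y x = 1).card ≤ 2 := by
  refine le_trans (card_le_card fun x hx => ?_) (card_offTip_contacts_le_two hX L (y := y) fun k hk => hD.subset (hocc k hk))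
  obtain ⟨hxXD, hyx⟩ := mem_filter.1 hx
  obtain ⟨hxX, hxD⟩ := mem_sdiff.1 hxXD
  refine mem_filter.2 ⟨hxX, hyx, fun k hk h => hxD (h ▸ hocc k hk), fun ht => hD.not_caps hzy hxX hxD hyx ?_⟩
  have := capsTriangleIn_of_tip L hy hocc ht
  rwa [LinearIsometryEquiv.apply_symm_apply, add_sub_cancel] at this

include hX hD hy hzy in
open scoped Classical in
/-- Row «eleven slots ⇒ 0» for a cap-closed core. -/
theorem junk_eq_zero_of_eleven_closed (hocc : ∀ k : Fin 12, k ≠ 2 → y + L (slotSite k) ∈ D) : ((X \ D).filter fun x => dist y x = 1).card = 0 := by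
  rw [card_eq_zero, eq_empty_iff_forall_notMem]
  intro x hx
  obtain ⟨hxXD, hyx⟩ := mem_filter.1 hx
  obtain ⟨hxX, hxD⟩ := mem_sdiff.1 hxXD
  have hxt : x = y + L (slotSite 2) := contact_eq_tip_of_eleven hX L (fun k hk => hD.subset (hocc k hk)) hxX hyx fun k hk h => hxD (h ▸ hocc k hk)
  have hocc9 : ∀ k ∈ lowerNine, y + L (slotSite k) ∈ D := fun k hk => hocc k (by intro h; subst h; simp [lowerNine] at hk)
  refine hD.not_caps hzy hxX hxD hyx ?_
  rw [hxt]; exact capsTriangleIn_of_tip L hy hocc9 (by simp [healTips])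

include hX hD hy hzy in
open scoped Classical in
/-- Row «ten slots (nine + upper slot 8) ⇒ ≤ 1» for a cap-closed core. -/
theorem junk_le_one_of_ten_closed (hocc : ∀ k ∈ lowerNine, y + L (slotSite k) ∈ D) (h8 : y + L (slotSite 8) ∈ D) :
    ((X \ D).filter fun x => dist y x = 1).card ≤ 1 := by
  have hDX := hD.subset
  have hfree : ∀ x ∈ (X \ D).filter (fun x => dist y x = 1), TenFree (L.symm (x - y)) ∧ L.symm (x - y) ∉ healTips := by
    intro x hx
    obtain ⟨hxXD, hyx⟩ := mem_filter.1 hx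
    obtain ⟨hxX, hxD⟩ := mem_sdiff.1 hxXD
    have hne : ∀ k ∈ lowerNine, x ≠ y + L (slotSite k) := fun k hk h => hxD (h ▸ hocc k hk)
    have hf : HealFree (L.symm (x - y)) := healFree_of_contact hX L (fun k hk => hDX (hocc k hk)) hxX hyx hne
    have h8' : ⟪L.symm (x - y), slotSite 8⟫_ℝ ≤ 1 / 2 :=
      inner_le_half_of_occupied hX L (norm_eq_one_of_mem_fccSlots (slotSite_mem 8)) (hDX h8) hxX hyx fun h => hxD (h ▸ h8)
    refine ⟨⟨hf, h8'⟩, fun ht => hD.not_caps hzy hxX hxD hyx ?_⟩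
    have := capsTriangleIn_of_tip L hy hocc ht
    rwa [LinearIsometryEquiv.apply_symm_apply, add_sub_cancel] at this
  rw [card_le_one]
  intro a ha b hb
  by_contra hab
  obtain ⟨hfa, hta⟩ := hfree a ha
  obtain ⟨hfb, -⟩ := hfree b hb
  have haX : a ∈ X := (mem_sdiff.1 (mem_filter.1 ha).1).1
  have hbX : b ∈ X := (mem_sdiff.1 (mem_filter.1 hb).1).1
  have hsep := inner_le_half_of_contacts hX L haX hbX hab (mem_filter.1 ha).2 (mem_filter.1 hb).2
  exact hta (mem_tips_of_tenFree_pair hfa hfb hsep).1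

include hX hD hy hzy in
open scoped Classical in
/-- Row «TEN′ (nine + hcp capper) ⇒ ≤ 1» for a cap-closed core. -/
theorem junk_le_one_of_tenHcp_closed (hocc : ∀ k ∈ lowerNine, y + L (slotSite k) ∈ D) (hocct : y + L (basalMirror (slotSite 1)) ∈ D) :
    ((X \ D).filter fun x => dist y x = 1).card ≤ 1 := by
  have hDX := hD.subset
  refine le_trans (card_le_card fun x hx => ?_) (card_offTip_contacts_le_one_of_ten' hX L (y := y) (fun k hk => hDX (hocc k hk)) (hDX hocct))
  obtain ⟨hxXD, hyx⟩ := mem_filter.1 hx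
  obtain ⟨hxX, hxD⟩ := mem_sdiff.1 hxXD
  have tipcase : ∀ t ∈ healTips, x = y + L t → False := fun t ht h =>
    hD.not_caps hzy hxX hxD hyx (h ▸ capsTriangleIn_of_tip L hy hocc ht)
  exact mem_filter.2 ⟨hxX, hyx, fun k hk h => hxD (h ▸ hocc k hk), fun h => hxD (h ▸ hocct),
    fun h => tipcase _ (by simp [healTips]) h, fun h => tipcase _ (by simp [healTips]) h⟩

include hX hD hy hzy in
open scoped Classical in
/-- Row «hexagon only ⇒ ≤ 4» for a cap-closed core. -/
theorem junk_le_four_of_hexagon_closed (hocc : ∀ k ∈ hexSix, y + L (slotSite k) ∈ D) : ((X \ D).filter fun x => dist y x = 1).card ≤ 4 := by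
  have hDX := hD.subset
  set L' : EuclideanSpace ℝ (Fin 3) ≃ₗᵢ[ℝ] EuclideanSpace ℝ (Fin 3) := (LinearIsometryEquiv.neg ℝ).trans L with hL'
  have hL'app : ∀ v, L' v = L (-v) := fun v => rfl
  have hocc' : ∀ k ∈ hexSix, y + L' (slotSite k) ∈ D := by
    intro k hk
    obtain ⟨k', hk', hkk'⟩ := hexSix_neg k hk
    rw [hL'app, ← hkk']
    exact hocc k' hk'
  refine le_trans (card_le_card fun x hx => ?_) (card_offTip_contacts_le_four_of_hexagon hX L (y := y) fun k hk => hDX (hocc k hk))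
  obtain ⟨hxXD, hyx⟩ := mem_filter.1 hx
  obtain ⟨hxX, hxD⟩ := mem_sdiff.1 hxXD
  refine mem_filter.2 ⟨hxX, hyx, fun k hk h => hxD (h ▸ hocc k hk), fun ht => hD.not_caps hzy hxX hxD hyx ?_, fun ht => hD.not_caps hzy hxX hxD hyx ?_⟩
  · have := capsTriangleIn_of_tip_hex L hy hocc ht
    rwa [LinearIsometryEquiv.apply_symm_apply, add_sub_cancel] at this
  · have := capsTriangleIn_of_tip_hex L' hy hocc' ht
    rwa [hL'app, neg_neg, LinearIsometryEquiv.apply_symm_apply, add_sub_cancel] at this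

include hX hD hy hzy in
open scoped Classical in
/-- Row «hexagon − 1 + lower triple ⇒ ≤ 3» for a cap-closed core (the tongue argument of `…HealCapHexFive`). -/
theorem junk_le_three_of_hexFive_closed (hocc : ∀ k ∈ lowerNine, k ≠ 0 → y + L (slotSite k) ∈ D) : ((X \ D).filter fun x => dist y x = 1).card ≤ 3 := by
  have hDX := hD.subset
  set J := (X \ D).filter fun x => dist y x = 1 with hJ
  have hJX : ∀ x ∈ J, x ∈ X ∧ x ∉ D ∧ dist y x = 1 := fun x hx =>
    ⟨(mem_sdiff.1 (mem_filter.1 hx).1).1, (mem_sdiff.1 (mem_filter.1 hx).1).2, (mem_filter.1 hx).2⟩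
  have hnorm : ∀ x ∈ J, ‖L.symm (x - y)‖ = 1 := fun x hx => by
    rw [LinearIsometryEquiv.norm_map, ← dist_eq_norm, dist_comm]; exact (hJX x hx).2.2
  have hslot : ∀ x ∈ J, ∀ k ∈ lowerNine, k ≠ 0 → ⟪L.symm (x - y), slotSite k⟫_ℝ ≤ 1 / 2 := fun x hx k hk hk0 =>
    inner_le_half_of_occupied hX L (norm_eq_one_of_mem_fccSlots (slotSite_mem k)) (hDX (hocc k hk hk0)) (hJX x hx).1 (hJX x hx).2.2
      fun h => (hJX x hx).2.1 (h ▸ hocc k hk hk0)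
  have hsep : ∀ a ∈ J, ∀ b ∈ J, a ≠ b → ⟪L.symm (a - y), L.symm (b - y)⟫_ℝ ≤ 1 / 2 := fun a ha b hb hab =>
    inner_le_half_of_contacts hX L (hJX a ha).1 (hJX b hb).1 hab (hJX a ha).2.2 (hJX b hb).2.2
  have hsplit := Finset.card_filter_add_card_filter_not (s := J) (fun x => 1 / 2 < ⟪L.symm (x - y), slotSite 0⟫_ℝ)
  have hT : (J.filter fun x => 1 / 2 < ⟪L.symm (x - y), slotSite 0⟫_ℝ).card ≤ 1 := by
    rw [card_le_one]
    intro a ha b hb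
    by_contra hab
    obtain ⟨haJ, ha0⟩ := mem_filter.1 ha
    obtain ⟨hbJ, hb0⟩ := mem_filter.1 hb
    have hta : TongueDir (L.symm (a - y)) :=
      ⟨hnorm a haJ, hslot a haJ 4 (by decide) (by decide), hslot a haJ 9 (by decide) (by decide), hslot a haJ 5 (by decide) (by decide), ha0⟩
    have htb : TongueDir (L.symm (b - y)) :=
      ⟨hnorm b hbJ, hslot b hbJ 4 (by decide) (by decide), hslot b hbJ 9 (by decide) (by decide), hslot b hbJ 5 (by decide) (by decide), hb0⟩
    linarith [inner_gt_half_of_tongue hta htb, hsep a haJ b hbJ hab]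
  have hC : (J.filter fun x => ¬ 1 / 2 < ⟪L.symm (x - y), slotSite 0⟫_ℝ).card ≤ 2 := by
    by_contra hlt
    rw [not_le] at hlt
    obtain ⟨a, ha, b, hb, e, he, hab, hae, hbe⟩ := two_lt_card.1 hlt
    have hfree : ∀ x ∈ J.filter (fun x => ¬ 1 / 2 < ⟪L.symm (x - y), slotSite 0⟫_ℝ), x ∈ J ∧ HealFree (L.symm (x - y)) := by
      intro x hx
      obtain ⟨hxJ, hx0⟩ := mem_filter.1 hx
      refine ⟨hxJ, hnorm x hxJ, fun k hk => ?_⟩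
      by_cases hk0 : k = 0
      · subst hk0; exact le_of_not_gt hx0
      · exact hslot x hxJ k hk hk0
    have htip : ∀ x ∈ J, L.symm (x - y) ∈ healTips → L.symm (x - y) = slotSite 8 ∨ L.symm (x - y) = basalMirror (slotSite 5) := by
      intro x hxJ ht
      by_contra hne
      push Not at hne
      obtain ⟨hxX, hxD, hyx⟩ := hJX x hxJ
      refine hD.not_caps hzy hxX hxD hyx ?_
      have := capsTriangleIn_of_tip_off_zero L hy hocc ht hne.1 hne.2
      rwa [LinearIsometryEquiv.apply_symm_apply, add_sub_cancel] at this
    obtain ⟨haJ, hfa⟩ := hfree a ha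
    obtain ⟨hbJ, hfb⟩ := hfree b hb
    obtain ⟨heJ, hfe⟩ := hfree e he
    obtain ⟨ta, tb, te⟩ := healFree_three hfa hfb hfe (hsep a haJ b hbJ hab) (hsep a haJ e heJ hae) (hsep b hbJ e heJ hbe)
    have hinj : ∀ p q : EuclideanSpace ℝ (Fin 3), L.symm (p - y) = L.symm (q - y) → p = q := fun p q h =>
      sub_left_injective (L.symm.injective h)
    rcases htip a haJ ta with h1 | h1 <;> rcases htip b hbJ tb with h2 | h2 <;> rcases htip e heJ te with h3 | h3
    · exact hab (hinj a b (h1.trans h2.symm))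
    · exact hab (hinj a b (h1.trans h2.symm))
    · exact hae (hinj a e (h1.trans h3.symm))
    · exact hbe (hinj b e (h2.trans h3.symm))
    · exact hbe (hinj b e (h2.trans h3.symm))
    · exact hae (hinj a e (h1.trans h3.symm))
    · exact hab (hinj a b (h1.trans h2.symm))
    · exact hab (hinj a b (h1.trans h2.symm))
  omega

include hX hD in
open scoped Classical in
/-- The kissing row for a cap-closed core: junk contacts `≤ 12 −` core contacts. -/
theorem junk_le_kissing_closed (y : EuclideanSpace ℝ (Fin 3)) : ((X \ D).filter fun x => dist y x = 1).card ≤ 12 - (D.filter fun q => dist y q = 1).card := by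
  have hDX := hD.subset
  have hdisj : Disjoint ((X \ D).filter fun x => dist y x = 1) (D.filter fun q => dist y q = 1) := by
    rw [disjoint_left]
    intro x hx hx'
    exact (mem_sdiff.1 (mem_filter.1 hx).1).2 (mem_filter.1 hx').1
  have hsub : ((X \ D).filter fun x => dist y x = 1) ∪ (D.filter fun q => dist y q = 1) ⊆ X.filter fun q => dist y q = 1 := by
    intro x hx
    rcases mem_union.1 hx with h | h
    · exact mem_filter.2 ⟨(mem_sdiff.1 (mem_filter.1 h).1).1, (mem_filter.1 h).2⟩
    · exact mem_filter.2 ⟨hDX (mem_filter.1 h).1, (mem_filter.1 h).2⟩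
  have h12 := card_filter_dist_eq_one_le_twelve X hX y
  have hsum := (card_union_of_disjoint hdisj).symm.trans_le ((card_le_card hsub).trans h12)
  omega

end Rows

/-! ### The junk cap bound over all cap-closed cores -/

open scoped Classical in
/-- **JUNK CAP BOUND FOR CAP-CLOSED CORES**: for every `1`-separated `X`, payer point `z`, cap-closed core `D` in the window, and core ball `y` within `2` of `z`,
the junk contacts of `y` number at most `cap D y`. -/
def JunkCapBoundClosed (cap : Finset (EuclideanSpace ℝ (Fin 3)) → EuclideanSpace ℝ (Fin 3) → ℕ) : Prop :=
  ∀ X : Finset (EuclideanSpace ℝ (Fin 3)), (∀ p ∈ X, ∀ q ∈ X, p ≠ q → 1 ≤ dist p q) →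
  ∀ z : EuclideanSpace ℝ (Fin 3), ∀ D : Finset (EuclideanSpace ℝ (Fin 3)), IsCapClosed X z D →
  ∀ y ∈ D, dist z y ≤ 2 → ((X \ D).filter fun x => dist y x = 1).card ≤ cap D y

/-- The closed-core bound implies the canonical-core bound. -/
theorem junkCapBound_of_closed {cap : Finset (EuclideanSpace ℝ (Fin 3)) → EuclideanSpace ℝ (Fin 3) → ℕ} (h : JunkCapBoundClosed cap) : JunkCapBound cap :=
  fun X hX z _ S y hy hzy => h X hX z _ (isCapClosed_coreOf X z S) y hy hzy

/-- Monotonicity of the closed-core bound. -/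
theorem junkCapBoundClosed_mono {cap cap' : Finset (EuclideanSpace ℝ (Fin 3)) → EuclideanSpace ℝ (Fin 3) → ℕ} (h : JunkCapBoundClosed cap)
    (hle : ∀ D y, cap D y ≤ cap' D y) : JunkCapBoundClosed cap' :=
  fun X hX z D hD y hy hzy => (h X hX z D hD y hy hzy).trans (hle _ _)

open scoped Classical in
/-- A pattern row for cap-closed cores. -/
theorem junkCapBoundClosed_patternCap {pat : (EuclideanSpace ℝ (Fin 3) ≃ₗᵢ[ℝ] EuclideanSpace ℝ (Fin 3)) → Finset (EuclideanSpace ℝ (Fin 3)) → EuclideanSpace ℝ (Fin 3) → Prop}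
    {r : ℕ}
    (hrow : ∀ X : Finset (EuclideanSpace ℝ (Fin 3)), (∀ p ∈ X, ∀ q ∈ X, p ≠ q → 1 ≤ dist p q) → ∀ z D, IsCapClosed X z D → ∀ y ∈ D, dist z y ≤ 2 →
      ∀ L : EuclideanSpace ℝ (Fin 3) ≃ₗᵢ[ℝ] EuclideanSpace ℝ (Fin 3), pat L D y → ((X \ D).filter fun x => dist y x = 1).card ≤ r) :
    JunkCapBoundClosed (patternCap pat r) := by
  intro X hX z D hD y hy hzy
  unfold patternCap
  split_ifs with h
  · obtain ⟨L, hL⟩ := h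
    exact hrow X hX z D hD y hy hzy L hL
  · exact junk_contacts_le_twelve hX _ y

/-- **`JunkCapBoundClosed capTable₂`**: the table of record holds for every cap-closed core (not only the canonical one). -/
theorem junkCapBoundClosed_capTable₂ : JunkCapBoundClosed capTable₂ := by
  intro X hX z D hD y hy hzy
  have hk : ((X \ D).filter fun x => dist y x = 1).card ≤ kissingCap D y := junk_le_kissing_closed hX hD y
  have h11 : ((X \ D).filter fun x => dist y x = 1).card ≤ elevenCap D y :=
    junkCapBoundClosed_patternCap (pat := ElevenPat) (fun X hX z D hD y hy hzy L hL => (junk_eq_zero_of_eleven_closed hX hD hy hzy L hL).le) X hX z D hD y hy hzy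
  have h10 : ((X \ D).filter fun x => dist y x = 1).card ≤ tenCap D y :=
    junkCapBoundClosed_patternCap (pat := TenPat) (fun X hX z D hD y hy hzy L hL => junk_le_one_of_ten_closed hX hD hy hzy L hL.1 hL.2) X hX z D hD y hy hzy
  have h9 : ((X \ D).filter fun x => dist y x = 1).card ≤ nineCap D y :=
    junkCapBoundClosed_patternCap (pat := NinePat) (fun X hX z D hD y hy hzy L hL => junk_le_two_of_nine_closed hX hD hy hzy L hL) X hX z D hD y hy hzy
  have h6 : ((X \ D).filter fun x => dist y x = 1).card ≤ hexagonCap D y :=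
    junkCapBoundClosed_patternCap (pat := HexagonPat) (fun X hX z D hD y hy hzy L hL => junk_le_four_of_hexagon_closed hX hD hy hzy L hL) X hX z D hD y hy hzy
  have hT : ((X \ D).filter fun x => dist y x = 1).card ≤ tenHcpCap D y :=
    junkCapBoundClosed_patternCap (pat := TenHcpPat) (fun X hX z D hD y hy hzy L hL => junk_le_one_of_tenHcp_closed hX hD hy hzy L hL.1 hL.2) X hX z D hD y hy hzy
  have h5 : ((X \ D).filter fun x => dist y x = 1).card ≤ hexFiveCap D y :=
    junkCapBoundClosed_patternCap (pat := HexFivePat) (fun X hX z D hD y hy hzy L hL => junk_le_three_of_hexFive_closed hX hD hy hzy L hL) X hX z D hD y hy hzy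
  unfold capTable₂ capTable₁ capTable₀
  exact le_min (le_min (le_min (le_min (le_min (le_min hk h11) h10) h9) h6) hT) h5

end TailResidue

end Summit.Ventures.Crystal3D.Theorems

end
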